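import Summits.CriticalPhenomena.PercolationContinuityZ3.Theorems.PercNearOneGluingNoHeavyLowerTailKnQuestion8CoefficientwiseCoreClassKernelMixBridge
import Summits.CriticalPhenomena.PercolationContinuityZ3.Theorems.PercNearOneGluingNoHeavyLowerTailKnQuestion8CoefficientwiseCoreClassKernelMixParallelMain
import HarnessLib

/-!
# KB-MIX along a BRIDGE — sources of the one-sided form, and THEOREM TWO LEAVES without any hypothesis on the middle graph

Support file (`--supports stmt-CriticalPhenomena-4575`, closed), prover `prim-cplus-coupling` (gen 36).  No definitions, no notations, no named facts,
no sorries; standard axioms.  Memo `prim-cplus-coupling/A5-COUPLING-gen36.md` §2.  Companion of `…CoreClassKernelMixBridge` (THEOREMS A, B).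

ONE-SIDED(E; x, y) ('contact at `x` allowed'): `Σ_ω h(C_x ω ∪ C_y ω)k(…) + Σ_{y ∉ C_x ω} (hˣ(C_x ω) − hʸ(C_y(E∖ω)))(kˣ(C_x ω) − kʸ(C_y(E∖ω))) ≥ 0` for all
monotone `h, k` and monotone levels `0 ≤ hˣ, hʸ ≤ h`, `0 ≤ kˣ, kʸ ≤ k`.
* `Coefficientwise.coreClass_oneSided_of_properDom` — **THEOREM C**: a PROPER domination map of `(E; x, y)` (image avoiding `{y ∈ C_x}`) gives
  ONE-SIDED(E; x, y) — the LEAF transfer mechanism of gen 31 (`coreClass_kernelMix_of_properDom` + `oneRoot_transfer`).  Pocket-free blocks, bundles,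
  cycles and paths therefore start and end bridged chains.
* `Coefficientwise.coreClass_oneSided_empty` — the trivial side (a single vertex).
* `Coefficientwise.coreClass_kernelMixFull_leaf_any_leaf` — KB-MIX-FULL of `a′–M–b′` (two pendant terminals) for EVERY edge set `M`, all levels:
  trivial side, THEOREM B across `a′a`, THEOREM A across `bb′`.
* `Coefficientwise.coreClass_oneSided_bridge_allLevels`, `Coefficientwise.cwpa_coreClass_of_bridge` — the all-levels wrappers of THEOREMS B and A
  (CW-PA on the core class over ANY bridge graph whose two sides are one-sided at all levels).
* `Coefficientwise.cwpa_coreClass_of_leaf_any_leaf` — **THEOREM TWO LEAVES, UNCONDITIONAL**: CW-PA (all monotone `f, g`) on prim-lf-2's core class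
  `N(x) = N(z) = {a′, b′}` over `a′a + M + bb′` for EVERY middle graph `M` — gen 31's `cwpa_coreClass_of_leaf_leaf_of_dom` without the domination map
  (so leaf–Θ–leaf, leaf–core–leaf and every other two-pendant-terminal middle, where no domination map exists, are settled).
[cite: KozmaNitzan2024, Questions 8–9 (§5.5 p. 36) (context: the Question-8 pocket covariance programme)]
-/

namespace Summit.CriticalPhenomena.PercolationContinuityZ3.Theorems

open Finset Literature.Probability.Percolation

namespace Coefficientwise

variable {ι V : Type*}

open Classical in
/-- **THEOREM C (sources of the one-sided form): a PROPER domination map gives ONE-SIDED.**  Middle graph `E`, terminals `a, b`, a map `ψ` injective on the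
wall event with `ψ ω ⊆ E`, `C_a ω ∪ C_b(E∖ω) ⊆ C_a(ψω) ∪ C_b(ψω)` and `b ∉ C_a(ψ ω)` there.  Then for all monotone `h, k` and monotone levels
`0 ≤ hᵃ, hᵇ ≤ h`, `0 ≤ kᵃ, kᵇ ≤ k`:  `0 ≤ Σ_{ω ⊆ E} h(C_a ω ∪ C_b ω)k(…) + Σ_{ω : b ∉ C_a ω} (hᵃ(C_a ω) − hᵇ(C_b(E∖ω)))(kᵃ(C_a ω) − kᵇ(C_b(E∖ω)))`
(ONE-SIDED(E; a, b): contact at `a` allowed).  Proof: the wall part is KB-MIX from the proper map (`coreClass_kernelMix_of_properDom`, supply off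
`{b ∈ C_a ω}`); the contact cell `{b ∉ C_a ω, b ∈ C_a(E∖ω)}` is the one-root transfer (`oneRoot_transfer` with empty external sets) against the supply on
`{b ∈ C_a ω, b ∉ C_a(E∖ω)}`.  Pocket-free blocks, bundles, cycles, paths carry such maps (`…CoreClassDomPocketFree`).
[cite: KozmaNitzan2024, Questions 8–9 (§5.5 p. 36) (context)] -/
theorem coreClass_oneSided_of_properDom (ends : ι → Sym2 V) (E : Finset ι) (a b : V) (h k ha hb ka kb : Set V → ℝ)
    (hh : Monotone h) (hk : Monotone k) (mha : Monotone ha) (mhb : Monotone hb) (mka : Monotone ka) (mkb : Monotone kb)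
    (ha0 : ∀ X, 0 ≤ ha X) (hah : ∀ X, ha X ≤ h X) (hb0 : ∀ X, 0 ≤ hb X) (hbh : ∀ X, hb X ≤ h X)
    (ka0 : ∀ X, 0 ≤ ka X) (kak : ∀ X, ka X ≤ k X) (kb0 : ∀ X, 0 ≤ kb X) (kbk : ∀ X, kb X ≤ k X)
    (ψ : Finset ι → Finset ι)
    (hψE : ∀ ω, ω ⊆ E → b ∉ openCluster (ends '' (↑ω : Set ι)) a → b ∉ openCluster (ends '' (↑(E \ ω) : Set ι)) a → ψ ω ⊆ E)
    (hψcov : ∀ ω, ω ⊆ E → b ∉ openCluster (ends '' (↑ω : Set ι)) a → b ∉ openCluster (ends '' (↑(E \ ω) : Set ι)) a →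
      openCluster (ends '' (↑ω : Set ι)) a ∪ openCluster (ends '' (↑(E \ ω) : Set ι)) b ⊆
        openCluster (ends '' (↑(ψ ω) : Set ι)) a ∪ openCluster (ends '' (↑(ψ ω) : Set ι)) b)
    (hψinj : ∀ ω₁ ω₂, ω₁ ⊆ E → b ∉ openCluster (ends '' (↑ω₁ : Set ι)) a → b ∉ openCluster (ends '' (↑(E \ ω₁) : Set ι)) a →
      ω₂ ⊆ E → b ∉ openCluster (ends '' (↑ω₂ : Set ι)) a → b ∉ openCluster (ends '' (↑(E \ ω₂) : Set ι)) a → ψ ω₁ = ψ ω₂ → ω₁ = ω₂)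
    (hψprop : ∀ ω, ω ⊆ E → b ∉ openCluster (ends '' (↑ω : Set ι)) a → b ∉ openCluster (ends '' (↑(E \ ω) : Set ι)) a →
      b ∉ openCluster (ends '' (↑(ψ ω) : Set ι)) a) :
    0 ≤ (∑ ω ∈ E.powerset,
        h (openCluster (ends '' (↑ω : Set ι)) a ∪ openCluster (ends '' (↑ω : Set ι)) b) *
          k (openCluster (ends '' (↑ω : Set ι)) a ∪ openCluster (ends '' (↑ω : Set ι)) b))
      + ∑ ω ∈ E.powerset.filter (fun ω : Finset ι => b ∉ openCluster (ends '' (↑ω : Set ι)) a),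
        (ha (openCluster (ends '' (↑ω : Set ι)) a) - hb (openCluster (ends '' (↑(E \ ω) : Set ι)) b)) *
          (ka (openCluster (ends '' (↑ω : Set ι)) a) - kb (openCluster (ends '' (↑(E \ ω) : Set ι)) b)) := by
  set C : Finset ι → V → Set V := fun ω v => openCluster (ends '' (↑ω : Set ι)) v with hC
  change 0 ≤ (∑ ω ∈ E.powerset, h (C ω a ∪ C ω b) * k (C ω a ∪ C ω b))
      + ∑ ω ∈ E.powerset.filter (fun ω => b ∉ C ω a), (ha (C ω a) - hb (C (E \ ω) b)) * (ka (C ω a) - kb (C (E \ ω) b))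
  have hh0 : ∀ X, 0 ≤ h X := fun X => le_trans (ha0 X) (hah X)
  have hk0 : ∀ X, 0 ≤ k X := fun X => le_trans (ka0 X) (kak X)
  -- (1) the wall part with the supply off {b ∈ C_a ω}: KB-MIX from the proper map
  have hmix := coreClass_kernelMix_of_properDom ends E a b h k ha hb ka kb hh hk ha0 hah hb0 hbh ka0 kak kb0 kbk ψ hψE hψcov hψinj hψprop
  change 0 ≤ (∑ ω ∈ E.powerset.filter (fun ω => b ∉ C ω a), h (C ω a ∪ C ω b) * k (C ω a ∪ C ω b))
      + ∑ ω ∈ E.powerset.filter (fun ω => b ∉ C ω a ∧ b ∉ C (E \ ω) a), (ha (C ω a) - hb (C (E \ ω) b)) * (ka (C ω a) - kb (C (E \ ω) b)) at hmix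
  -- (2) the contact cell against the supply on {b ∈ C_a ω, b ∉ C_a(E∖ω)}: one-root transfer with empty external sets
  have htr := oneRoot_transfer ends E a b ∅ ∅ h k ha ka hb kb mha mka mhb mkb ha0 hah ka0 kak hb0 kb0
  simp only [Set.empty_union] at htr
  have hR0 : 0 ≤ ∑ ω ∈ E.powerset, (if b ∈ C ω a ∧ b ∉ C (E \ ω) a then (h (C ω a) - hb (C ω a)) * (k (C ω a) - kb (C ω a)) else 0) :=
    Finset.sum_nonneg fun ω _ => by
      by_cases hc : b ∈ C ω a ∧ b ∉ C (E \ ω) a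
      · rw [if_pos hc]; exact mul_nonneg (sub_nonneg.mpr (hbh _)) (sub_nonneg.mpr (kbk _))
      · rw [if_neg hc]
  change ∑ ω ∈ E.powerset, (if b ∈ C ω a ∧ b ∉ C (E \ ω) a then (h (C ω a) - hb (C ω a)) * (k (C ω a) - kb (C ω a)) else 0)
    ≤ ∑ ω ∈ E.powerset, ((if b ∈ C ω a ∧ b ∉ C (E \ ω) a then h (C ω a) * k (C ω a) else 0)
      + (if b ∈ C (E \ ω) a ∧ b ∉ C ω a then (ha (C ω a) - hb (C (E \ ω) a)) * (ka (C ω a) - kb (C (E \ ω) a)) else 0)) at htr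
  -- (3) bookkeeping: split the supply into {b ∉ C_a} ⊔ {b ∈ C_a, b ∉ C_a(E∖ω)} ⊔ rest, the anti-sum into wall ⊔ contact cell
  have hsplit_sup : ∑ ω ∈ E.powerset, h (C ω a ∪ C ω b) * k (C ω a ∪ C ω b)
      ≥ (∑ ω ∈ E.powerset.filter (fun ω => b ∉ C ω a), h (C ω a ∪ C ω b) * k (C ω a ∪ C ω b))
        + ∑ ω ∈ E.powerset, (if b ∈ C ω a ∧ b ∉ C (E \ ω) a then h (C ω a) * k (C ω a) else 0) := by
    rw [Finset.sum_filter, ge_iff_le, ← Finset.sum_add_distrib]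
    refine Finset.sum_le_sum fun ω _ => ?_
    by_cases h1 : b ∉ C ω a
    · rw [if_pos h1, if_neg (fun hx => h1 hx.1)]; linarith
    · by_cases h2 : b ∉ C (E \ ω) a
      · rw [if_neg h1, if_pos ⟨not_not.mp h1, h2⟩]
        have hS : C ω a ∪ C ω b = C ω a := by
          have hba : C ω b = C ω a := by
            ext y; constructor
            · intro hy; exact SimpleGraph.Reachable.trans (not_not.mp h1) hy
            · intro hy; exact SimpleGraph.Reachable.trans (SimpleGraph.Reachable.symm (not_not.mp h1)) hy
          rw [hba, Set.union_self]
        rw [hS]; linarith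
      · rw [if_neg h1, if_neg (fun hx => h2 hx.2)]; linarith [mul_nonneg (hh0 (C ω a ∪ C ω b)) (hk0 (C ω a ∪ C ω b))]
  have hsplit_anti : ∑ ω ∈ E.powerset.filter (fun ω => b ∉ C ω a), (ha (C ω a) - hb (C (E \ ω) b)) * (ka (C ω a) - kb (C (E \ ω) b))
      = (∑ ω ∈ E.powerset.filter (fun ω => b ∉ C ω a ∧ b ∉ C (E \ ω) a), (ha (C ω a) - hb (C (E \ ω) b)) * (ka (C ω a) - kb (C (E \ ω) b)))
        + ∑ ω ∈ E.powerset, (if b ∈ C (E \ ω) a ∧ b ∉ C ω a then (ha (C ω a) - hb (C (E \ ω) a)) * (ka (C ω a) - kb (C (E \ ω) a)) else 0) := by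
    rw [Finset.sum_filter, Finset.sum_filter, ← Finset.sum_add_distrib]
    refine Finset.sum_congr rfl fun ω _ => ?_
    by_cases h1 : b ∉ C ω a
    · by_cases h2 : b ∉ C (E \ ω) a
      · rw [if_pos h1, if_pos ⟨h1, h2⟩, if_neg (fun hx => h2 hx.1)]; ring
      · have hba : C (E \ ω) b = C (E \ ω) a := by
          ext y; constructor
          · intro hy; exact SimpleGraph.Reachable.trans (not_not.mp h2) hy
          · intro hy; exact SimpleGraph.Reachable.trans (SimpleGraph.Reachable.symm (not_not.mp h2)) hy
        rw [if_pos h1, if_neg (fun hx => h2 hx.2), if_pos ⟨not_not.mp h2, h1⟩, hba]; ring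
    · rw [if_neg h1, if_neg (fun hx => h1 hx.1), if_neg (fun hx => h1 hx.2)]; ring
  rw [Finset.sum_add_distrib] at htr
  rw [hsplit_anti]
  linarith [hsplit_sup, hmix, htr, hR0]

open Classical in
/-- **The trivial side.**  For the empty edge set and `c₁ = a` the glued one-sided hypothesis of the bridge theorems holds: the anti-sum is empty and the
supply is `h(B ∪ {a})k(B ∪ {a}) ≥ 0`.  (Start of every chain: a pendant terminal.) [cite: KozmaNitzan2024, Questions 8–9 (§5.5 p. 36) (context)] -/
theorem coreClass_oneSided_empty (ends : ι → Sym2 V) (a : V) (h k ha hb ka kb : Set V → ℝ)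
    (ha0 : ∀ X, 0 ≤ ha X) (hah : ∀ X, ha X ≤ h X) (ka0 : ∀ X, 0 ≤ ka X) (kak : ∀ X, ka X ≤ k X) (B : Set V) :
    0 ≤ (∑ ω₁ ∈ (∅ : Finset ι).powerset,
        h (B ∪ (openCluster (ends '' (↑ω₁ : Set ι)) a ∪ openCluster (ends '' (↑ω₁ : Set ι)) a)) *
          k (B ∪ (openCluster (ends '' (↑ω₁ : Set ι)) a ∪ openCluster (ends '' (↑ω₁ : Set ι)) a)))
      + ∑ ω₁ ∈ (∅ : Finset ι).powerset.filter (fun ω₁ : Finset ι => a ∉ openCluster (ends '' (↑ω₁ : Set ι)) a),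
        (hb (B ∪ openCluster (ends '' (↑ω₁ : Set ι)) a) - ha (openCluster (ends '' (↑((∅ : Finset ι) \ ω₁) : Set ι)) a)) *
          (kb (B ∪ openCluster (ends '' (↑ω₁ : Set ι)) a) - ka (openCluster (ends '' (↑((∅ : Finset ι) \ ω₁) : Set ι)) a)) := by
  have hh0 : ∀ X, 0 ≤ h X := fun X => le_trans (ha0 X) (hah X)
  have hk0 : ∀ X, 0 ≤ k X := fun X => le_trans (ka0 X) (kak X)
  have h2 : ∑ ω₁ ∈ (∅ : Finset ι).powerset.filter (fun ω₁ : Finset ι => a ∉ openCluster (ends '' (↑ω₁ : Set ι)) a),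
        (hb (B ∪ openCluster (ends '' (↑ω₁ : Set ι)) a) - ha (openCluster (ends '' (↑((∅ : Finset ι) \ ω₁) : Set ι)) a)) *
          (kb (B ∪ openCluster (ends '' (↑ω₁ : Set ι)) a) - ka (openCluster (ends '' (↑((∅ : Finset ι) \ ω₁) : Set ι)) a)) = 0 := by
    refine Finset.sum_eq_zero fun ω₁ hω₁ => ?_
    rw [Finset.mem_filter] at hω₁
    exact absurd (mem_openCluster_self _ _) hω₁.2
  rw [h2, add_zero]
  exact Finset.sum_nonneg fun ω₁ _ => mul_nonneg (hh0 _) (hk0 _)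

open Classical in
/-- **KB-MIX-FULL over `a′–M–b′` for EVERY middle graph `M` (two pendant terminals; no hypothesis on `M`).**  `EH` any edge set, `e₁ = a′a ∉ EH`,
`e₂ = b′b ∉ insert e₁ EH`, `a′` on no edge of `EH`, `b′` on no edge of `insert e₁ EH`, `a′ ≠ a, b`, `b′ ≠ b, a′`.  Then KB-MIX-FULL of
`(insert e₂ (insert e₁ EH); a′, b′)` holds for all monotone `h, k` and monotone levels `0 ≤ hᵃ, hᵇ ≤ h`, `0 ≤ kᵃ, kᵇ ≤ k`.  Proof: the trivial side `{a′}`,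
THEOREM B across `e₁` (the one-sided form reaches `b` through the arbitrary `EH`), THEOREM A across `e₂` with the trivial side `{b′}`.  (gen 31's THEOREM TWO
LEAVES needed a domination map of `(EH; a, b)`; leaf–Θ–leaf and leaf–core–leaf, where no domination map of the composed graph exists, are covered.)
[cite: KozmaNitzan2024, Questions 8–9 (§5.5 p. 36) (context)] -/
theorem coreClass_kernelMixFull_leaf_any_leaf (ends : ι → Sym2 V) (EH : Finset ι) (a a' b b' : V) (e₁ e₂ : ι)
    (he₁ : e₁ ∉ EH) (he₂ : e₂ ∉ insert e₁ EH) (hends₁ : ends e₁ = s(a', a)) (hends₂ : ends e₂ = s(b', b))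
    (ha'E : ∀ i ∈ EH, a' ∉ ends i) (hb'E : ∀ i ∈ insert e₁ EH, b' ∉ ends i)
    (ha'a : a' ≠ a) (ha'b : a' ≠ b) (hb'b : b' ≠ b) (hb'a' : b' ≠ a')
    (h k ha hb ka kb : Set V → ℝ) (hh : Monotone h) (hk : Monotone k)
    (mha : Monotone ha) (mhb : Monotone hb) (mka : Monotone ka) (mkb : Monotone kb)
    (ha0 : ∀ X, 0 ≤ ha X) (hah : ∀ X, ha X ≤ h X) (hb0 : ∀ X, 0 ≤ hb X) (hbh : ∀ X, hb X ≤ h X)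
    (ka0 : ∀ X, 0 ≤ ka X) (kak : ∀ X, ka X ≤ k X) (kb0 : ∀ X, 0 ≤ kb X) (kbk : ∀ X, kb X ≤ k X) :
    0 ≤ (∑ ω ∈ (insert e₂ (insert e₁ EH)).powerset,
        h (openCluster (ends '' (↑ω : Set ι)) a' ∪ openCluster (ends '' (↑ω : Set ι)) b') *
          k (openCluster (ends '' (↑ω : Set ι)) a' ∪ openCluster (ends '' (↑ω : Set ι)) b'))
      + ∑ ω ∈ (insert e₂ (insert e₁ EH)).powerset.filter (fun ω : Finset ι => b' ∉ openCluster (ends '' (↑ω : Set ι)) a' ∧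
            b' ∉ openCluster (ends '' (↑((insert e₂ (insert e₁ EH)) \ ω) : Set ι)) a'),
        (ha (openCluster (ends '' (↑ω : Set ι)) a') - hb (openCluster (ends '' (↑((insert e₂ (insert e₁ EH)) \ ω) : Set ι)) b')) *
          (ka (openCluster (ends '' (↑ω : Set ι)) a') - kb (openCluster (ends '' (↑((insert e₂ (insert e₁ EH)) \ ω) : Set ι)) b')) := by
  have hU : ∀ (B : Set V) (X Y : Set V), X ⊆ Y → B ∪ X ⊆ B ∪ Y := fun B X Y hXY => Set.union_subset_union_right B hXY
  -- step 1: THEOREM B across e₁ from the trivial side {a′}: the one-sided form of (a′a + EH; b, a′), at every glue B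
  have S1 : ∀ B : Set V, 0 ≤ (∑ ω ∈ (∅ ∪ insert e₁ EH).powerset,
        h (B ∪ (openCluster (ends '' (↑ω : Set ι)) b ∪ openCluster (ends '' (↑ω : Set ι)) a')) *
          k (B ∪ (openCluster (ends '' (↑ω : Set ι)) b ∪ openCluster (ends '' (↑ω : Set ι)) a')))
      + ∑ ω ∈ (∅ ∪ insert e₁ EH).powerset.filter (fun ω : Finset ι => a' ∉ openCluster (ends '' (↑ω : Set ι)) b),
        (hb (B ∪ openCluster (ends '' (↑ω : Set ι)) b) - ha (openCluster (ends '' (↑((∅ ∪ insert e₁ EH) \ ω) : Set ι)) a')) *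
          (kb (B ∪ openCluster (ends '' (↑ω : Set ι)) b) - ka (openCluster (ends '' (↑((∅ ∪ insert e₁ EH) \ ω) : Set ι)) a')) := by
    intro B
    exact coreClass_oneSided_bridge ends ∅ EH e₁ a' a a' b (Finset.disjoint_empty_left EH) (Finset.notMem_empty e₁) he₁ hends₁
      (fun i hi => absurd hi (Finset.notMem_empty i)) ha'E (fun i hi => absurd hi (Finset.notMem_empty i))
      ha'E ha'a (fun i hi => absurd hi (Finset.notMem_empty i)) (Ne.symm ha'b) ha'b
      (fun X => h (B ∪ X)) (fun X => k (B ∪ X)) ha (fun X => hb (B ∪ X)) ka (fun X => kb (B ∪ X))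
      (fun X Y hXY => hh (hU B X Y hXY)) (fun X Y hXY => hk (hU B X Y hXY)) mha (fun X Y hXY => mhb (hU B X Y hXY)) mka
      (fun X Y hXY => mkb (hU B X Y hXY))
      (fun X => ha0 _) (fun X => le_trans (hah X) (hh Set.subset_union_right)) (fun X => hb0 _) (fun X => hbh _)
      (fun X => ka0 _) (fun X => le_trans (kak X) (hk Set.subset_union_right)) (fun X => kb0 _) (fun X => kbk _)
      (fun B' => coreClass_oneSided_empty ends a' (fun X => h (B ∪ X)) (fun X => k (B ∪ X)) ha (fun X => hb (B ∪ X)) ka (fun X => kb (B ∪ X))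
        (fun X => ha0 _) (fun X => le_trans (hah X) (hh Set.subset_union_right)) (fun X => ka0 _) (fun X => le_trans (kak X) (hk Set.subset_union_right)) B')
  -- step 2: THEOREM A across e₂ with the trivial side {b′}
  have hends₂' : ends e₂ = s(b, b') := by rw [hends₂, Sym2.eq_swap]
  have he₂' : e₂ ∉ ∅ ∪ insert e₁ EH := by rw [Finset.empty_union]; exact he₂
  have hb'E' : ∀ i ∈ ∅ ∪ insert e₁ EH, b' ∉ ends i := by rw [Finset.empty_union]; exact hb'E
  have key := coreClass_kernelMixFull_bridge ends (∅ ∪ insert e₁ EH) ∅ e₂ b b' a' b' (Finset.disjoint_empty_right _) he₂' (Finset.notMem_empty e₂) hends₂'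
    (fun i hi j hj => absurd hj (Finset.notMem_empty j)) (fun j hj => absurd hj (Finset.notMem_empty j)) hb'E'
    (fun j hj => absurd hj (Finset.notMem_empty j)) (Ne.symm hb'a') hb'E' hb'b (Ne.symm hb'a')
    h k ha hb ka kb hh hk ha0 hah hb0 hbh ka0 kak kb0 kbk S1
    (fun A => coreClass_oneSided_empty ends b' h k hb ha kb ka hb0 hbh kb0 kbk A)
  have hEq : (∅ ∪ insert e₁ EH) ∪ insert e₂ (∅ : Finset ι) = insert e₂ (insert e₁ EH) := by
    ext i; simp only [Finset.empty_union, Finset.mem_union, Finset.mem_insert, Finset.notMem_empty, or_false]; tauto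
  rw [hEq] at key
  exact key

open Classical in
/-- **THEOREM TWO LEAVES, UNCONDITIONAL — CW-PA on the core class `N(x) = N(z) = {a′, b′}` over `a′a + M + bb′` for EVERY middle graph `M`.**
Core-class bookkeeping as in `cwpa_coreClass_of_leaf_leaf_of_dom` (middle `E₂ = insert e₂ (insert e₁ E_H)`, terminals `a′, b′` joined to `x, z` by
`ixa, ixb, iza, izb`), but WITHOUT any domination-map hypothesis on `(E_H; a, b)`: for all monotone `f, g`,
`0 ≤ Σ_{s ⊆ E₀ : z ∉ C_x(s), z ∉ C_x(E₀∖s)} f(C_x s)·(g(C_x s) − g(C_x(E₀∖s)))`. [cite: KozmaNitzan2024, Questions 8–9 (§5.5 p. 36) (context)] -/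
theorem cwpa_coreClass_of_leaf_any_leaf (ends : ι → Sym2 V) (EH E₀ : Finset ι) (x z a a' b b' : V) (e₁ e₂ ixa ixb iza izb : ι)
    (he₁ : e₁ ∉ EH) (he₂ : e₂ ∉ insert e₁ EH) (hends₁ : ends e₁ = s(a', a)) (hends₂ : ends e₂ = s(b', b))
    (ha'E : ∀ i ∈ EH, a' ∉ ends i) (hb'E : ∀ i ∈ insert e₁ EH, b' ∉ ends i)
    (ha'a : a' ≠ a) (ha'b : a' ≠ b) (hb'b : b' ≠ b) (hb'a' : b' ≠ a')
    (hxa : ends ixa = s(x, a')) (hxb : ends ixb = s(x, b')) (hza : ends iza = s(z, a')) (hzb : ends izb = s(z, b'))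
    (hH : ∀ i ∈ insert e₂ (insert e₁ EH), x ∉ ends i ∧ z ∉ ends i)
    (hE₀ : ∀ i, i ∈ E₀ ↔ i ∈ insert e₂ (insert e₁ EH) ∨ i = ixa ∨ i = ixb ∨ i = iza ∨ i = izb)
    (hnot : ixa ∉ insert e₂ (insert e₁ EH) ∧ ixb ∉ insert e₂ (insert e₁ EH) ∧ iza ∉ insert e₂ (insert e₁ EH) ∧ izb ∉ insert e₂ (insert e₁ EH))
    (hd : ixa ≠ ixb ∧ ixa ≠ iza ∧ ixa ≠ izb ∧ ixb ≠ iza ∧ ixb ≠ izb ∧ iza ≠ izb)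
    (hxz : x ≠ z) (hxa' : x ≠ a') (hxb' : x ≠ b') (hza' : z ≠ a') (hzb' : z ≠ b')
    (f g : Set V → ℝ) (hf : Monotone f) (hg : Monotone g) :
    0 ≤ ∑ s ∈ E₀.powerset.filter (fun s : Finset ι => z ∉ openCluster (ends '' (↑s : Set ι)) x ∧ z ∉ openCluster (ends '' (↑(E₀ \ s) : Set ι)) x),
      f (openCluster (ends '' (↑s : Set ι)) x) * (g (openCluster (ends '' (↑s : Set ι)) x) - g (openCluster (ends '' (↑(E₀ \ s) : Set ι)) x)) :=
  cwpa_coreClass_of_kernelMixFull_allLevels ends (insert e₂ (insert e₁ EH)) E₀ x z a' b' ixa ixb iza izb hxa hxb hza hzb hH hE₀ hnot hd hxz hxa' hxb' hza' hzb'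
    (fun h' k' ha' hb' ka' kb' hh' hk' mha' mhb' mka' mkb' ha0' hah' hb0' hbh' ka0' kak' kb0' kbk' =>
      coreClass_kernelMixFull_leaf_any_leaf ends EH a a' b b' e₁ e₂ he₁ he₂ hends₁ hends₂ ha'E hb'E ha'a ha'b hb'b hb'a'
        h' k' ha' hb' ka' kb' hh' hk' mha' mhb' mka' mkb' ha0' hah' hb0' hbh' ka0' kak' kb0' kbk') f g hf hg

open Classical in
/-- **THEOREM B, all levels.**  Bridge setting of `coreClass_oneSided_bridge`; if ONE-SIDED(E₁; c₁, a) holds for ALL monotone test functions and levels, then so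
does ONE-SIDED(E₁ ∪ {e} ∪ E₂; b, a) (stated at the given levels).  The glued instances needed by THEOREM B are the levels `h(B ∪ ·)`, `hᵇ(B ∪ ·)`, `hᵃ`.
[cite: KozmaNitzan2024, Questions 8–9 (§5.5 p. 36) (context)] -/
theorem coreClass_oneSided_bridge_allLevels (ends : ι → Sym2 V) (E₁ E₂ : Finset ι) (e : ι) (c₁ c₂ a b : V)
    (hdisj : Disjoint E₁ E₂) (he₁ : e ∉ E₁) (he₂ : e ∉ E₂) (hends : ends e = s(c₁, c₂))
    (hsep : ∀ i ∈ E₁, ∀ j ∈ E₂, ∀ u, u ∈ ends i → u ∈ ends j → False)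
    (hc₁ : ∀ j ∈ E₂, c₁ ∉ ends j) (hc₂ : ∀ i ∈ E₁, c₂ ∉ ends i)
    (haE : ∀ j ∈ E₂, a ∉ ends j) (hac : a ≠ c₂) (hbE : ∀ i ∈ E₁, b ∉ ends i) (hbc : b ≠ c₁) (hab : a ≠ b)
    (hOS₁all : ∀ h k hx hy kx ky : Set V → ℝ, Monotone h → Monotone k → Monotone hx → Monotone hy → Monotone kx → Monotone ky →
      (∀ X, 0 ≤ hx X) → (∀ X, hx X ≤ h X) → (∀ X, 0 ≤ hy X) → (∀ X, hy X ≤ h X) →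
      (∀ X, 0 ≤ kx X) → (∀ X, kx X ≤ k X) → (∀ X, 0 ≤ ky X) → (∀ X, ky X ≤ k X) →
      0 ≤ (∑ ω₁ ∈ E₁.powerset,
          h (openCluster (ends '' (↑ω₁ : Set ι)) c₁ ∪ openCluster (ends '' (↑ω₁ : Set ι)) a) *
            k (openCluster (ends '' (↑ω₁ : Set ι)) c₁ ∪ openCluster (ends '' (↑ω₁ : Set ι)) a))
        + ∑ ω₁ ∈ E₁.powerset.filter (fun ω₁ : Finset ι => a ∉ openCluster (ends '' (↑ω₁ : Set ι)) c₁),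
          (hx (openCluster (ends '' (↑ω₁ : Set ι)) c₁) - hy (openCluster (ends '' (↑(E₁ \ ω₁) : Set ι)) a)) *
            (kx (openCluster (ends '' (↑ω₁ : Set ι)) c₁) - ky (openCluster (ends '' (↑(E₁ \ ω₁) : Set ι)) a)))
    (h k ha hb ka kb : Set V → ℝ) (hh : Monotone h) (hk : Monotone k)
    (mha : Monotone ha) (mhb : Monotone hb) (mka : Monotone ka) (mkb : Monotone kb)
    (ha0 : ∀ X, 0 ≤ ha X) (hah : ∀ X, ha X ≤ h X) (hb0 : ∀ X, 0 ≤ hb X) (hbh : ∀ X, hb X ≤ h X)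
    (ka0 : ∀ X, 0 ≤ ka X) (kak : ∀ X, ka X ≤ k X) (kb0 : ∀ X, 0 ≤ kb X) (kbk : ∀ X, kb X ≤ k X) :
    0 ≤ (∑ ω ∈ (E₁ ∪ insert e E₂).powerset,
        h (openCluster (ends '' (↑ω : Set ι)) b ∪ openCluster (ends '' (↑ω : Set ι)) a) *
          k (openCluster (ends '' (↑ω : Set ι)) b ∪ openCluster (ends '' (↑ω : Set ι)) a))
      + ∑ ω ∈ (E₁ ∪ insert e E₂).powerset.filter (fun ω : Finset ι => a ∉ openCluster (ends '' (↑ω : Set ι)) b),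
        (hb (openCluster (ends '' (↑ω : Set ι)) b) - ha (openCluster (ends '' (↑((E₁ ∪ insert e E₂) \ ω) : Set ι)) a)) *
          (kb (openCluster (ends '' (↑ω : Set ι)) b) - ka (openCluster (ends '' (↑((E₁ ∪ insert e E₂) \ ω) : Set ι)) a)) := by
  have hU : ∀ (B : Set V) (X Y : Set V), X ⊆ Y → B ∪ X ⊆ B ∪ Y := fun B X Y hXY => Set.union_subset_union_right B hXY
  refine coreClass_oneSided_bridge ends E₁ E₂ e c₁ c₂ a b hdisj he₁ he₂ hends hsep hc₁ hc₂ haE hac hbE hbc hab h k ha hb ka kb hh hk mha mhb mka mkb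
    ha0 hah hb0 hbh ka0 kak kb0 kbk ?_
  intro B
  exact hOS₁all (fun X => h (B ∪ X)) (fun X => k (B ∪ X)) (fun X => hb (B ∪ X)) ha (fun X => kb (B ∪ X)) ka
    (fun X Y hXY => hh (hU B X Y hXY)) (fun X Y hXY => hk (hU B X Y hXY)) (fun X Y hXY => mhb (hU B X Y hXY)) mha
    (fun X Y hXY => mkb (hU B X Y hXY)) mka
    (fun X => hb0 _) (fun X => hbh _) (fun X => ha0 _) (fun X => le_trans (hah X) (hh Set.subset_union_right))
    (fun X => kb0 _) (fun X => kbk _) (fun X => ka0 _) (fun X => le_trans (kak X) (hk Set.subset_union_right))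

open Classical in
/-- **THEOREM A, all levels — CW-PA on the core class over a bridge graph.**  Bridge setting; ONE-SIDED(E₁; c₁, a) and ONE-SIDED(E₂; c₂, b) for all levels;
core-class bookkeeping for the middle `E_H = E₁ ∪ {e} ∪ E₂` with terminals `a, b` joined to `x, z` (as in `cwpa_coreClass_of_kernelMixFull_allLevels`).  Then CW-PA
on the core class `N(x) = N(z) = {a, b}`: for all monotone `f, g`, `0 ≤ Σ_{s ⊆ E₀ : z ∉ C_x s, z ∉ C_x(E₀∖s)} f(C_x s)(g(C_x s) − g(C_x(E₀∖s)))`.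
[cite: KozmaNitzan2024, Questions 8–9 (§5.5 p. 36) (context)] -/
theorem cwpa_coreClass_of_bridge (ends : ι → Sym2 V) (E₁ E₂ E₀ : Finset ι) (e : ι) (c₁ c₂ a b x z : V) (ixa ixb iza izb : ι)
    (hdisj : Disjoint E₁ E₂) (he₁ : e ∉ E₁) (he₂ : e ∉ E₂) (hends : ends e = s(c₁, c₂))
    (hsep : ∀ i ∈ E₁, ∀ j ∈ E₂, ∀ u, u ∈ ends i → u ∈ ends j → False)
    (hc₁ : ∀ j ∈ E₂, c₁ ∉ ends j) (hc₂ : ∀ i ∈ E₁, c₂ ∉ ends i)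
    (haE : ∀ j ∈ E₂, a ∉ ends j) (hac : a ≠ c₂) (hbE : ∀ i ∈ E₁, b ∉ ends i) (hbc : b ≠ c₁) (hab : a ≠ b)
    (hxa : ends ixa = s(x, a)) (hxb : ends ixb = s(x, b)) (hza : ends iza = s(z, a)) (hzb : ends izb = s(z, b))
    (hH : ∀ i ∈ E₁ ∪ insert e E₂, x ∉ ends i ∧ z ∉ ends i) (hE₀ : ∀ i, i ∈ E₀ ↔ i ∈ E₁ ∪ insert e E₂ ∨ i = ixa ∨ i = ixb ∨ i = iza ∨ i = izb)
    (hnot : ixa ∉ E₁ ∪ insert e E₂ ∧ ixb ∉ E₁ ∪ insert e E₂ ∧ iza ∉ E₁ ∪ insert e E₂ ∧ izb ∉ E₁ ∪ insert e E₂)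
    (hd : ixa ≠ ixb ∧ ixa ≠ iza ∧ ixa ≠ izb ∧ ixb ≠ iza ∧ ixb ≠ izb ∧ iza ≠ izb)
    (hxz : x ≠ z) (hxa' : x ≠ a) (hxb' : x ≠ b) (hza' : z ≠ a) (hzb' : z ≠ b)
    (hOS₁all : ∀ h k hx hy kx ky : Set V → ℝ, Monotone h → Monotone k → Monotone hx → Monotone hy → Monotone kx → Monotone ky →
      (∀ X, 0 ≤ hx X) → (∀ X, hx X ≤ h X) → (∀ X, 0 ≤ hy X) → (∀ X, hy X ≤ h X) →
      (∀ X, 0 ≤ kx X) → (∀ X, kx X ≤ k X) → (∀ X, 0 ≤ ky X) → (∀ X, ky X ≤ k X) →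
      0 ≤ (∑ ω₁ ∈ E₁.powerset,
          h (openCluster (ends '' (↑ω₁ : Set ι)) c₁ ∪ openCluster (ends '' (↑ω₁ : Set ι)) a) *
            k (openCluster (ends '' (↑ω₁ : Set ι)) c₁ ∪ openCluster (ends '' (↑ω₁ : Set ι)) a))
        + ∑ ω₁ ∈ E₁.powerset.filter (fun ω₁ : Finset ι => a ∉ openCluster (ends '' (↑ω₁ : Set ι)) c₁),
          (hx (openCluster (ends '' (↑ω₁ : Set ι)) c₁) - hy (openCluster (ends '' (↑(E₁ \ ω₁) : Set ι)) a)) *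
            (kx (openCluster (ends '' (↑ω₁ : Set ι)) c₁) - ky (openCluster (ends '' (↑(E₁ \ ω₁) : Set ι)) a)))
    (hOS₂all : ∀ h k hx hy kx ky : Set V → ℝ, Monotone h → Monotone k → Monotone hx → Monotone hy → Monotone kx → Monotone ky →
      (∀ X, 0 ≤ hx X) → (∀ X, hx X ≤ h X) → (∀ X, 0 ≤ hy X) → (∀ X, hy X ≤ h X) →
      (∀ X, 0 ≤ kx X) → (∀ X, kx X ≤ k X) → (∀ X, 0 ≤ ky X) → (∀ X, ky X ≤ k X) →
      0 ≤ (∑ ω₂ ∈ E₂.powerset,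
          h (openCluster (ends '' (↑ω₂ : Set ι)) c₂ ∪ openCluster (ends '' (↑ω₂ : Set ι)) b) *
            k (openCluster (ends '' (↑ω₂ : Set ι)) c₂ ∪ openCluster (ends '' (↑ω₂ : Set ι)) b))
        + ∑ ω₂ ∈ E₂.powerset.filter (fun ω₂ : Finset ι => b ∉ openCluster (ends '' (↑ω₂ : Set ι)) c₂),
          (hx (openCluster (ends '' (↑ω₂ : Set ι)) c₂) - hy (openCluster (ends '' (↑(E₂ \ ω₂) : Set ι)) b)) *
            (kx (openCluster (ends '' (↑ω₂ : Set ι)) c₂) - ky (openCluster (ends '' (↑(E₂ \ ω₂) : Set ι)) b)))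
    (f g : Set V → ℝ) (hf : Monotone f) (hg : Monotone g) :
    0 ≤ ∑ s ∈ E₀.powerset.filter (fun s : Finset ι => z ∉ openCluster (ends '' (↑s : Set ι)) x ∧ z ∉ openCluster (ends '' (↑(E₀ \ s) : Set ι)) x),
      f (openCluster (ends '' (↑s : Set ι)) x) * (g (openCluster (ends '' (↑s : Set ι)) x) - g (openCluster (ends '' (↑(E₀ \ s) : Set ι)) x)) := by
  have hU : ∀ (B : Set V) (X Y : Set V), X ⊆ Y → B ∪ X ⊆ B ∪ Y := fun B X Y hXY => Set.union_subset_union_right B hXY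
  refine cwpa_coreClass_of_kernelMixFull_allLevels ends (E₁ ∪ insert e E₂) E₀ x z a b ixa ixb iza izb hxa hxb hza hzb hH hE₀ hnot hd hxz hxa' hxb' hza' hzb'
    ?_ f g hf hg
  intro h k ha hb ka kb hh hk mha mhb mka mkb ha0 hah hb0 hbh ka0 kak kb0 kbk
  refine coreClass_kernelMixFull_bridge ends E₁ E₂ e c₁ c₂ a b hdisj he₁ he₂ hends hsep hc₁ hc₂ haE hac hbE hbc hab h k ha hb ka kb hh hk
    ha0 hah hb0 hbh ka0 kak kb0 kbk ?_ ?_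
  · intro B
    exact hOS₁all (fun X => h (B ∪ X)) (fun X => k (B ∪ X)) (fun X => hb (B ∪ X)) ha (fun X => kb (B ∪ X)) ka
      (fun X Y hXY => hh (hU B X Y hXY)) (fun X Y hXY => hk (hU B X Y hXY)) (fun X Y hXY => mhb (hU B X Y hXY)) mha
      (fun X Y hXY => mkb (hU B X Y hXY)) mka
      (fun X => hb0 _) (fun X => hbh _) (fun X => ha0 _) (fun X => le_trans (hah X) (hh Set.subset_union_right))
      (fun X => kb0 _) (fun X => kbk _) (fun X => ka0 _) (fun X => le_trans (kak X) (hk Set.subset_union_right))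
  · intro A
    exact hOS₂all (fun X => h (A ∪ X)) (fun X => k (A ∪ X)) (fun X => ha (A ∪ X)) hb (fun X => ka (A ∪ X)) kb
      (fun X Y hXY => hh (hU A X Y hXY)) (fun X Y hXY => hk (hU A X Y hXY)) (fun X Y hXY => mha (hU A X Y hXY)) mhb
      (fun X Y hXY => mka (hU A X Y hXY)) mkb
      (fun X => ha0 _) (fun X => hah _) (fun X => hb0 _) (fun X => le_trans (hbh X) (hh Set.subset_union_right))
      (fun X => ka0 _) (fun X => kak _) (fun X => kb0 _) (fun X => le_trans (kbk X) (hk Set.subset_union_right))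

end Coefficientwise

end Summit.CriticalPhenomena.PercolationContinuityZ3.Theorems
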